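import Summits.ABC.IUTFork.Repair.CandMochizuki7RamEIsoFull
import HarnessLib

/-!
# IUT REPAIR BRANCH (rung LADDER-ABC:A2.RP) — PINS versus OBJECT on the ramified bed, for EVERY reading of Ism inside `GL(I)`:
# two region pins ∧ the OBJECT sentence force the typed Corollary, hence the window `3m ≤ 5(e−1)`; at every deeper datum they are jointly UNSATISFIABLE

Proof-only record file (D-0012; no definitions, no `Prop` fact; adjudication-closure files IMPORTED, not edited) of the abc-iut cell, seat abc-iut-rp-m1
(gen 5; class (ii)). TAKES NO SIDE on [IUTchIII] Cor. 3.12 or on any author; typed ≠ proved. Over `Repair/CandMochizuki7RamEIsoPins` (the reading-generic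
bed RAM_{e;G₁,G₂}^H(p, m) with honest (b): `ramLatticeWithH` / `ramSettingWithH`, any sets `1 ∈ G₁, G₂` of automorphisms of `ℚ^e`) and abc-iut-rp-m1
gen 4's ∀-ISM BARRIER (`Cor312RamifiedEIsmBarrier.not_statementWith`: for every reading inside `GL(I) = GL_e(ℤ_(p))` the typed Corollary FAILS once
`3m > 5(e−1)`).

THE DIRECTOR'S TEST T-c asks whether «H ∧ typed Thm 3.11 (i)–(iii) ∧ PinnedRegions3» is satisfiable; for the residual itself (H := the OBJECT sentence
`PilotKummerIndRelated`) the seat's gen-5 files give the two poles on the ramified toy — isometric readings: pins ✓, OBJECT ✗ (`isoF_pinned_countermodel`);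
Dupuy–Hilado reading: OBJECT ✓ for `e > 4m`, pins ✗ (`ramEH_object_model_not_pinned`). THIS FILE closes the deep half for EVERY reading in between:
* `statementWithH_of_pinned_object` — for every reading `1 ∈ G₁, G₂ ⊆ GL(I)`: the two region pins (Θ-pin, q-pin with the honest q-datum) ∧ the OBJECT
  sentence ⟹ the typed Corollary 3.12 (abc-iut-w5-d230's `statement_of_pinned3_of_pilotKummerIndRelated` with Thm 3.11 (ii)(b) by `rfl` and gen 4's
  reading-generic bridge hypotheses; the link pin is not needed);
* **`not_object_of_pinned_deep` — for every reading inside `GL(I)`, every `3m > 5(e−1)`, every region reading `ρ` satisfying the two region pins: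
  ¬`PilotKummerIndRelated`** (∀-reading, ∀-ρ); `pinned_object_imp_window` — pins ∧ OBJECT ⟹ `3m ≤ 5(e−1)` and `hullK₁ + hullK₂ ≤ 2m`;
* `deep_Tc_unsat` — packaged: at every deep ramified datum the T-c conjunction «OBJECT ∧ PinnedRegions3» has NO model among the readings of Ism
  inside `GL(I)` and the region readings `ρ` (with the honest q-datum), although the typed Thm 3.11 holds for all of them (`ramFullF_statement`).
READING (neutral): on the ramified toy the Corollary's pins tie the OBJECT sentence to the typed inequality itself, so wherever the inequality fails
(all deep data, every reading) the pinned OBJECT fails with it; the shallow window is the only place a pinned OBJECT-model could live, and there the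
two poles of record are «pins without OBJECT» (isometric) and «OBJECT without pins» (DH). Toy (`l⋇ = 2`, one place); no repair claimed; nothing here
bears on [IUTchIII] Cor. 3.12. [claim: Mochizuki2012, status: disputed] [cite: ScholzeStix2018, §2.2 pp. 9–10] [cite: DupuyHilado2025, §4.9]
-/

noncomputable section

open Set

namespace Summit.ABC.IUTFork.Repair.CandMochizuki7RamE

open Thm311 Cor312 Cor312.Checks Cor312.IdentifiedNonVacuity Cor312Vol Cor312Vol.NaiveWitness Cor312Vol.PinnedWitness
  Cor312Vol.RamifiedEWitness Literature.IUT.LogThetaLattice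

variable (p e : ℕ) {G₁ G₂ : Set ((Fin e → ℚ) ≃ₗ[ℚ] (Fin e → ℚ))}
  (h₁ : LinearEquiv.refl ℚ (Fin e → ℚ) ∈ G₁) (h₂ : LinearEquiv.refl ℚ (Fin e → ℚ) ∈ G₂) [NeZero e] [hp : Fact p.Prime] (m : ℕ)
  (hG₁ : G₁ ⊆ latticeAuts p e) (hG₂ : G₂ ⊆ latticeAuts p e)

include hG₁ hG₂

/-- **For every reading inside `GL(I)`: the two region pins ∧ the OBJECT sentence ⟹ the typed Corollary 3.12** on RAM_{e;G₁,G₂}^H(p, m)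
(abc-iut-w5-d230's (P″)-shaped derivation modulo the residual, fed with Thm 3.11 (ii)(b) by `rfl` and the reading-generic bridge hypotheses).
[claim: Mochizuki2012, status: disputed] -/
theorem statementWithH_of_pinned_object (hm : 1 ≤ m)
    (ρ : (∀ v : toyIndex.V, v ∈ toyIndex.Vbad → Set ((ramShellsE p e).StarPacket v)) →
      ∀ (j : toyIndex.Label) (vQ : toyIndex.VQ), Set ((ramShellsE p e).Packet j vQ))
    (hpin : PinnedRegions (ramLatticeWithH p e G₁ G₂ h₁ h₂ m) (ramSettingWithH p e G₁ G₂ h₁ h₂ m) ρ (qDatumE p e m))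
    (hobj : PilotKummerIndRelated (ramLatticeWithH p e G₁ G₂ h₁ h₂ m) (ramSettingWithH p e G₁ G₂ h₁ h₂ m) ρ (qDatumE p e m)) :
    (ramSettingWithH p e G₁ G₂ h₁ h₂ m).Statement :=
  statement_of_qRegion_mem_possibleImages (ramSettingWithH_bridgeHyps_absLogQPos p e h₁ h₂ m hG₁ hG₂ hm).1 fun i vQ =>
    (reading3_iff_pilotKummerIndRelated _ _ ρ _ (kummerB_ramWithH p e G₁ G₂ h₁ h₂ m) hpin).2 hobj (Setting.labelSucc i) vQ

/-- **Pins ∧ OBJECT ⟹ the window**: `3m ≤ 5(e−1)` and, exactly, `hullK₁ + hullK₂ ≤ 2m` (gen 4's ∀-ISM barrier read backwards).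
[claim: Mochizuki2012, status: disputed] -/
theorem pinned_object_imp_window (hm : 1 ≤ m)
    (ρ : (∀ v : toyIndex.V, v ∈ toyIndex.Vbad → Set ((ramShellsE p e).StarPacket v)) →
      ∀ (j : toyIndex.Label) (vQ : toyIndex.VQ), Set ((ramShellsE p e).Packet j vQ))
    (hpin : PinnedRegions (ramLatticeWithH p e G₁ G₂ h₁ h₂ m) (ramSettingWithH p e G₁ G₂ h₁ h₂ m) ρ (qDatumE p e m))
    (hobj : PilotKummerIndRelated (ramLatticeWithH p e G₁ G₂ h₁ h₂ m) (ramSettingWithH p e G₁ G₂ h₁ h₂ m) ρ (qDatumE p e m)) :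
    3 * (m : ℤ) ≤ 5 * ((e : ℤ) - 1) ∧
      hullK e m (Setting.labelSucc ((0 : Fin 2) : Fin toyIndex.lstar)) + hullK e m (Setting.labelSucc ((1 : Fin 2) : Fin toyIndex.lstar)) ≤ 2 * (m : ℤ) :=
  have hS : (ramSettingWith p e G₁ G₂ h₁ h₂ m).Statement := statementWithH_of_pinned_object p e h₁ h₂ m hG₁ hG₂ hm ρ hpin hobj
  ⟨statementWith_imp_le p e h₁ h₂ m hG₁ hG₂ hS, statementWith_imp_hullK_le p e h₁ h₂ m hG₁ hG₂ hS⟩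

/-- **AT EVERY DEEP DATUM (`3m > 5(e−1)`), FOR EVERY READING OF Ism INSIDE `GL(I)` AND EVERY REGION READING `ρ` SATISFYING THE TWO REGION PINS, THE
OBJECT SENTENCE FAILS.** [claim: Mochizuki2012, status: disputed] -/
theorem not_object_of_pinned_deep (h5 : 5 * ((e : ℤ) - 1) < 3 * (m : ℤ))
    (ρ : (∀ v : toyIndex.V, v ∈ toyIndex.Vbad → Set ((ramShellsE p e).StarPacket v)) →
      ∀ (j : toyIndex.Label) (vQ : toyIndex.VQ), Set ((ramShellsE p e).Packet j vQ))
    (hpin : PinnedRegions (ramLatticeWithH p e G₁ G₂ h₁ h₂ m) (ramSettingWithH p e G₁ G₂ h₁ h₂ m) ρ (qDatumE p e m)) :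
    ¬ PilotKummerIndRelated (ramLatticeWithH p e G₁ G₂ h₁ h₂ m) (ramSettingWithH p e G₁ G₂ h₁ h₂ m) ρ (qDatumE p e m) := fun hobj =>
  have hm : 1 ≤ m := by
    have : (0 : ℤ) ≤ (e : ℤ) - 1 := by have := NeZero.one_le (n := e); omega
    have : (0 : ℤ) < 3 * (m : ℤ) := by omega
    omega
  not_statementWith p e h₁ h₂ m hG₁ hG₂ h5 (statementWithH_of_pinned_object p e h₁ h₂ m hG₁ hG₂ hm ρ hpin hobj)

/-- … in particular for every THREE-pinned `ρ` (the link pin is idle here). [claim: Mochizuki2012, status: disputed] -/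
theorem not_object_of_pinned3_deep (h5 : 5 * ((e : ℤ) - 1) < 3 * (m : ℤ))
    (ρ : (∀ v : toyIndex.V, v ∈ toyIndex.Vbad → Set ((ramShellsE p e).StarPacket v)) →
      ∀ (j : toyIndex.Label) (vQ : toyIndex.VQ), Set ((ramShellsE p e).Packet j vQ))
    (hpin : PinnedRegions3 (ramLatticeWithH p e G₁ G₂ h₁ h₂ m) (ramSettingWithH p e G₁ G₂ h₁ h₂ m) ρ (qDatumE p e m)) :
    ¬ PilotKummerIndRelated (ramLatticeWithH p e G₁ G₂ h₁ h₂ m) (ramSettingWithH p e G₁ G₂ h₁ h₂ m) ρ (qDatumE p e m) :=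
  not_object_of_pinned_deep p e h₁ h₂ m hG₁ hG₂ h5 ρ hpin.1

/-- **`deep_Tc_unsat` — THE T-c CONJUNCTION «OBJECT ∧ PinnedRegions3» HAS NO MODEL ON THE DEEP RAMIFIED FAMILY**, among all readings of the
strip-automorphisms / Ism inside `GL(I)` and all region readings `ρ` (honest q-datum), although the typed [IUTchIII] Thm 3.11 (i)–(iii) HOLDS on every such
bed (`ramFullF_statement`) — stated on the full bed RAM_{e;G₁,G₂}^F(p, m) (same shells, column and glue). [claim: Mochizuki2012, status: disputed] -/
theorem deep_Tc_unsat (h5 : 5 * ((e : ℤ) - 1) < 3 * (m : ℤ)) :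
    (ramFullF p e G₁ G₂ h₁ h₂ m).Statement ∧
      ∀ ρ, PinnedRegions3 (ramFullF p e G₁ G₂ h₁ h₂ m).toLatticeSituation (ramSettingF p e G₁ G₂ h₁ h₂ m) ρ (qDatumE p e m) →
        ¬ PilotKummerIndRelated (ramFullF p e G₁ G₂ h₁ h₂ m).toLatticeSituation (ramSettingF p e G₁ G₂ h₁ h₂ m) ρ (qDatumE p e m) :=
  ⟨ramFullF_statement p e G₁ G₂ h₁ h₂ m, fun ρ hpin => not_object_of_pinned3_deep p e h₁ h₂ m hG₁ hG₂ h5 ρ hpin⟩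

omit hG₁ hG₂ in
/-- **The two instances of record**: the Dupuy–Hilado reading `GL(I)` and the isometric reading `isoKE` — at every deep datum neither admits a pinned
model of the OBJECT sentence. [claim: Mochizuki2012, status: disputed] -/
theorem deep_Tc_unsat_instances (h5 : 5 * ((e : ℤ) - 1) < 3 * (m : ℤ)) :
    (∀ ρ, PinnedRegions3 (ramFullF p e (latticeAuts p e) (latticeAuts p e) (refl_mem_latticeAuts p e) (refl_mem_latticeAuts p e) m).toLatticeSituation
          (ramSettingF p e (latticeAuts p e) (latticeAuts p e) (refl_mem_latticeAuts p e) (refl_mem_latticeAuts p e) m) ρ (qDatumE p e m) →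
        ¬ PilotKummerIndRelated
          (ramFullF p e (latticeAuts p e) (latticeAuts p e) (refl_mem_latticeAuts p e) (refl_mem_latticeAuts p e) m).toLatticeSituation
          (ramSettingF p e (latticeAuts p e) (latticeAuts p e) (refl_mem_latticeAuts p e) (refl_mem_latticeAuts p e) m) ρ (qDatumE p e m)) ∧
      ∀ ρ, PinnedRegions3 (ramFullF p e (isoKE p e) (isoKE p e) (refl_mem_isoKE p e) (refl_mem_isoKE p e) m).toLatticeSituation
          (ramSettingF p e (isoKE p e) (isoKE p e) (refl_mem_isoKE p e) (refl_mem_isoKE p e) m) ρ (qDatumE p e m) →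
        ¬ PilotKummerIndRelated (ramFullF p e (isoKE p e) (isoKE p e) (refl_mem_isoKE p e) (refl_mem_isoKE p e) m).toLatticeSituation
          (ramSettingF p e (isoKE p e) (isoKE p e) (refl_mem_isoKE p e) (refl_mem_isoKE p e) m) ρ (qDatumE p e m) :=
  ⟨(deep_Tc_unsat p e _ _ m subset_rfl subset_rfl h5).2,
    (deep_Tc_unsat p e _ _ m (isoKE_subset_latticeAuts p e) (isoKE_subset_latticeAuts p e) h5).2⟩

end Summit.ABC.IUTFork.Repair.CandMochizuki7RamE

end
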